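import Mathlib
import Summits.NavierStokesRegularity.NavierStokesRegularity.Theorems.EulerZoomLiouvillePowerGaugeEulerLiouvilleNeedleStagnationKinematics
import Summits.NavierStokesRegularity.NavierStokesRegularity.Theorems.EulerZoomLiouvillePowerGaugeEulerLiouvilleSelfSimilarVorticalNodeThin

/-!
# RIGID SPECTRUM ON VORTICAL STAGNATION CURVES: `spec DW = {1+γ, 0, 2γ−1}` (ROUND-40 §2′ (N5), nsreg-p2 g33)

Width piece for crux `EulerZoomLiouville.PowerGaugeEulerLiouville` (stmt-NavierStokesRegularity-19832), by name under
LEAD 19832 (ns-typeII-p2 g12); seat ns-in-ser-c g3 (director-ns inputs-36), `--supports stmt-NavierStokesRegularity-19832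
--as helper`.  The last TEXT item of ROUND-40 §2′ and the kernel anchor of ROUND-41 (E3)(a) «on a stagnation CURVE:
`spec DW = {1+γ, 0, −ργ}`».

At a VORTICAL STAGNATION POINT `z` of the similarity wind `W = γy + U` of a self-similar Euler profile (`W z = 0`,
`Ω(z) = curl U z ≠ 0`) the kinematics file t40e gives `DW(z)Ω = (1+γ)Ω` (`Stagnation.fderiv_transport_apply_curl_of_stagnation`)
and `tr DW(z) = 3γ` (`Stagnation.trace_fderiv_selfSimilarTransport`).  If moreover `DW(z)` has a kernel vector `k ≠ 0` — the
tangent of a stagnation CURVE through `z` — then the characteristic polynomial of `DW(z)` is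
`X (X − (1+γ)) (X − (2γ−1))`, so `2γ − 1` is an eigenvalue:

* **`hasEigenvalue_two_mul_sub_one_of_stagnation`** — `2γ − 1` is an eigenvalue of `DW(z)` (for `1 + γ ≠ 0`);
* `exists_eigenvector_two_mul_sub_one_of_stagnation` — an eigenvector form;
* `two_mul_inv_two_add_sub_one` — with `γ = 1/(2+ρ)`: `2γ − 1 = −ργ`, the hovering exponent of ROUND-39/40.

Route: the characteristic polynomial `p` of `DW(z)` is monic cubic with `coeff 2 = −3γ` (trace), `coeff 0 = 0` (`k` in the
kernel) and `p(1+γ) = 0` (`Ω` eigenvector, `Module.End.hasEigenvalue_iff_isRoot_charpoly`); these force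
`p(2γ−1) = (2γ−1)²((2γ−1) − 3γ + (1+γ)) = 0` (charpoly bookkeeping as in `…SelfSimilarVorticalNodeThin` / `…DSSNodeSpectralSplitting`; the trace identity is the tree's
`Kelvin.trace_eq_neg_charpoly_coeff_two`).
HONEST FRAMING: linear algebra for HYPOTHETICAL self-similar Euler profiles; proves nothing about the crux E (19832 OPEN), any
door Target, or Navier–Stokes regularity; no summit statement is touched. [folklore]
-/

noncomputable section

set_option linter.dupNamespace false

open Set Function
open scoped RealInnerProductSpace

namespace Summit.NavierStokesRegularity.NavierStokesRegularity.Theorems.PowerGaugeEulerLiouville.Stagnation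

open Literature.Analysis Literature.Analysis.FluidPDE
open Summit.NavierStokesRegularity.NavierStokesRegularity.Theorems.PowerGaugeEulerLiouville

variable {γ : ℝ} {U : EuclideanSpace ℝ (Fin 3) → EuclideanSpace ℝ (Fin 3)} {P : EuclideanSpace ℝ (Fin 3) → ℝ}

/-- **(N5) RIGID SPECTRUM ON VORTICAL STAGNATION CURVES.**  `(U, P)` a self-similar Euler profile, `z` a stagnation point of the
similarity wind (`W z = 0`) with `curl U z ≠ 0`, and `k ≠ 0` a kernel vector of `DW(z)` (the tangent of a stagnation curve);
assume `1 + γ ≠ 0`.  Then `2γ − 1` is an eigenvalue of `DW(z)` — the spectrum is exactly `{1+γ, 0, 2γ−1}`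
(`= {1+γ, 0, −ργ}` for `γ = 1/(2+ρ)`). [folklore] -/
theorem hasEigenvalue_two_mul_sub_one_of_stagnation (hprof : IsSelfSimilarEulerProfile γ 0 U P) (hγ : 1 + γ ≠ 0)
    {z : EuclideanSpace ℝ (Fin 3)} (hz : selfSimilarTransport γ 0 U z = 0) (hΩ : curl U z ≠ 0)
    {k : EuclideanSpace ℝ (Fin 3)} (hk0 : k ≠ 0) (hk : fderiv ℝ (selfSimilarTransport γ 0 U) z k = 0) :
    Module.End.HasEigenvalue
      (fderiv ℝ (selfSimilarTransport γ 0 U) z : EuclideanSpace ℝ (Fin 3) →ₗ[ℝ] EuclideanSpace ℝ (Fin 3))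
      (2 * γ - 1) := by
  set M := fderiv ℝ (selfSimilarTransport γ 0 U) z with hM
  set f : EuclideanSpace ℝ (Fin 3) →ₗ[ℝ] EuclideanSpace ℝ (Fin 3) :=
    (M : EuclideanSpace ℝ (Fin 3) →ₗ[ℝ] EuclideanSpace ℝ (Fin 3)) with hf
  set p : Polynomial ℝ := f.charpoly with hp
  have hp3 : p.natDegree = 3 := by rw [hp, LinearMap.charpoly_natDegree, finrank_euclideanSpace_fin]
  have hmonic : p.Monic := LinearMap.charpoly_monic f
  have hc3 : p.coeff 3 = 1 := by
    have h := hmonic.coeff_natDegree; rwa [hp3] at h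
  -- every eigenvalue is a root: `r³ + c₂ r² + c₁ r + c₀ = 0`
  have hroot : ∀ {r : ℝ} {v : EuclideanSpace ℝ (Fin 3)}, v ≠ 0 → M v = r • v →
      r ^ 3 + p.coeff 2 * r ^ 2 + p.coeff 1 * r + p.coeff 0 = 0 := by
    intro r v hv hMv
    have hev : Module.End.HasEigenvalue f r :=
      Module.End.hasEigenvalue_of_hasEigenvector ⟨Module.End.mem_eigenspace_iff.2 (by exact hMv), hv⟩
    have h := (Module.End.hasEigenvalue_iff_isRoot_charpoly f r).1 hev
    rw [Polynomial.IsRoot.def, Polynomial.eval_eq_sum_range, ← hp, hp3] at h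
    simp only [Finset.sum_range_succ, Finset.sum_range_zero, zero_add, hc3, one_mul, pow_zero, mul_one] at h
    linarith
  -- the trace: `c₂ = −3γ`
  have hU : DifferentiableAt ℝ U z := (hprof.contDiff_velocity.differentiable (by norm_num)).differentiableAt
  have htr : LinearMap.trace ℝ (EuclideanSpace ℝ (Fin 3)) f = 3 * γ :=
    trace_fderiv_selfSimilarTransport hU (hprof.divFree z)
  have hc2 : p.coeff 2 = -(3 * γ) := by
    have h := Kelvin.trace_eq_neg_charpoly_coeff_two f
    rw [htr] at h
    linarith
  -- the kernel vector: `c₀ = 0`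
  have hc0 : p.coeff 0 = 0 := by
    have h := hroot (r := 0) hk0 (by rw [zero_smul]; exact hk)
    simpa using h
  -- the vorticity eigenvector: `p(1+γ) = 0` determines `c₁`
  have h1 := hroot hΩ (fderiv_transport_apply_curl_of_stagnation hprof hz)
  rw [hc2, hc0] at h1
  have hc1 : p.coeff 1 = (1 + γ) * (2 * γ - 1) := by
    have h1' : (1 + γ) * (p.coeff 1 - (1 + γ) * (2 * γ - 1)) = 0 := by linear_combination h1
    rcases mul_eq_zero.1 h1' with h | h
    · exact absurd h hγ
    · linarith
  -- hence `p(2γ − 1) = 0`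
  have hr : p.IsRoot (2 * γ - 1) := by
    rw [Polynomial.IsRoot.def, Polynomial.eval_eq_sum_range, hp3]
    simp only [Finset.sum_range_succ, Finset.sum_range_zero, zero_add, hc3, one_mul, pow_zero, mul_one, hc2, hc1, hc0]
    ring
  exact (Module.End.hasEigenvalue_iff_isRoot_charpoly f _).2 hr

/-- **(N5), eigenvector form.**  Under the hypotheses of `hasEigenvalue_two_mul_sub_one_of_stagnation` there is `v ≠ 0` with
`DW(z) v = (2γ − 1) v` — a direction transverse to the stagnation curve that is backward-REPELLING at rate `1 − 2γ`
(`= ργ` in the window). [folklore] -/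
theorem exists_eigenvector_two_mul_sub_one_of_stagnation (hprof : IsSelfSimilarEulerProfile γ 0 U P)
    (hγ : 1 + γ ≠ 0) {z : EuclideanSpace ℝ (Fin 3)} (hz : selfSimilarTransport γ 0 U z = 0) (hΩ : curl U z ≠ 0)
    {k : EuclideanSpace ℝ (Fin 3)} (hk0 : k ≠ 0) (hk : fderiv ℝ (selfSimilarTransport γ 0 U) z k = 0) :
    ∃ v : EuclideanSpace ℝ (Fin 3), v ≠ 0 ∧ fderiv ℝ (selfSimilarTransport γ 0 U) z v = (2 * γ - 1) • v := by
  obtain ⟨v, hv⟩ := (hasEigenvalue_two_mul_sub_one_of_stagnation hprof hγ hz hΩ hk0 hk).exists_hasEigenvector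
  exact ⟨v, hv.2, Module.End.mem_eigenspace_iff.1 hv.1⟩

/-- The window arithmetic: for `γ = 1/(2+ρ)` (`ρ ≠ −2`), `2γ − 1 = −ργ` — the third eigenvalue on a vortical stagnation
curve is minus the hovering exponent of ROUND-39/40. [folklore] -/
theorem two_mul_inv_two_add_sub_one {ρ : ℝ} (hρ : 2 + ρ ≠ 0) :
    2 * (1 / (2 + ρ)) - 1 = -(ρ * (1 / (2 + ρ))) := by
  field_simp
  ring

end Summit.NavierStokesRegularity.NavierStokesRegularity.Theorems.PowerGaugeEulerLiouville.Stagnation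

end
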